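import Summits.ResolutionOfSingularities.ResolutionOfSingularities.Theorems.RadicialJungCleanModelsCleanLU3DimThreeCentre
import HarnessLib

/-!
# Crux stmt-ResolutionOfSingularities-15917 (`RadicialJung.CleanModels`), skeleton `Sketch` rev 13: the registered stub
# `stub_cleanLU3_of_frame` — PROVED

The stub (registered on stmt-15917 by `Cruxes/CleanModels/Lines/Sketch.lean` rev 13): Cossart–Piltant's (S,h,E)-frame
(the registered consumer shape `stub_cp2019Thm15iFrame` of INPUTS row F-CP15-frame, taken as the hypothesis `hF`) gives
CLEAN LOCAL UNIFORMIZATION at every valuation of a function field `K/k` of characteristic `p` whose centre on a regular affine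
model `A` of dimension `≤ 3` has a 3-dimensional local ring, for every `g₀ ∈ K ∖ K^p`.  This is exactly
`cleanLU_of_frame_of_dimThreeCentre` (`RadicialJungCleanModelsCleanLU3DimThreeCentre.lean`, p659057) with the stub's binder
order (the dimension bound on `A` is not used).  Nothing here proves resolution in characteristic `p`; the dim-3 slice of the
crux still owes `stub_cp2019Thm15iFrame` (a printed theorem, to be typed) and `stub_cleanPatching3` (not in print).
-/

noncomputable section

set_option linter.dupNamespace false

open IsLocalRing Polynomial
open Literature.AlgebraicGeometry.Resolution

namespace Summit.ResolutionOfSingularities.ResolutionOfSingularities.Theorems.RadicialJung.CleanModels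

/-- **Registered stub `stub_cleanLU3_of_frame` (skeleton `Sketch` rev 13 of crux stmt-15917), proved**: the frame gives
clean local uniformization at 3-dimensional centres. [folklore] -/
theorem stub_cleanLU3_of_frame
    (hF : ∀ (p : ℕ), p.Prime →
      ∀ (S : Type) [CommRing S] [IsRegularLocalRing S],
        IsExcellentRing S → ringKrullDim S = 3 → CharP S p →
      ∀ (K : Type) [Field K] [Algebra S K] [IsFractionRing S K] (f : S),
        (∀ c : K, c ^ p ≠ algebraMap S K f) →
      ∀ (O : ValuationSubring K), (algebraMap S K).range ≤ O.toSubring →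
        (∀ s ∈ IsLocalRing.maximalIdeal S, O.valuation (algebraMap S K s) < 1) →
      ∃ (n : ℕ) (B : ℕ → Subring K) (g : ℕ → K),
        B 0 = locAtCentre (algebraMap S K).range O ∧ g 0 = algebraMap S K f ∧
        (∀ i ≤ n, B i ≤ O.toSubring ∧ IsRegularLocalRing (B i) ∧ g i ∈ B i) ∧
        (∀ i < n, ∃ P : Ideal (B i), IsRegularLocalRing ((B i) ⧸ P) ∧
          IsLocalBlowupAlong O (B i) P (B (i + 1)) ∧
          ∃ c d : K, c ≠ 0 ∧ g (i + 1) = c ^ p * g i + d ^ p) ∧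
        ∀ hg : g n ∈ B n, IsRegularLocalRing (AdjoinRoot (Polynomial.X ^ p - Polynomial.C (⟨g n, hg⟩ : B n)))) :
    ∀ (p : ℕ), p.Prime →
    ∀ (k : Type) [Field k] [CharP k p] (K : Type) [Field K] [Algebra k K]
      (O : ValuationSubring K) (A : Subalgebra k K), A.toSubring ≤ O.toSubring → A.FG → IsFractionRing A K →
      ringKrullDim A ≤ 3 → IsRegularLocalRing (locAtCentre A.toSubring O) →
      ringKrullDim (locAtCentre A.toSubring O) = 3 →
      ∀ g₀ : K, (∀ c : K, c ^ p ≠ g₀) →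
      ∃ (A' : Subalgebra k K), A'.toSubring ≤ O.toSubring ∧ A ≤ A' ∧ A'.FG ∧
        ∃ (_ : IsRegularLocalRing (locAtCentre A'.toSubring O)) (c : Fin p → K), (∃ j : Fin p, (j : ℕ) ≠ 0 ∧ c j ≠ 0) ∧
          ((∃ (d m : ℕ) (hmd : m ≤ d) (t : Fin d → ↥(locAtCentre A'.toSubring O)) (a : Fin m → ℕ) (u : ↥(locAtCentre A'.toSubring O)), IsUnit u ∧
              Ideal.span (Set.range t) = IsLocalRing.maximalIdeal ↥(locAtCentre A'.toSubring O) ∧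
              ringKrullDim ↥(locAtCentre A'.toSubring O) = (d : WithBot ℕ∞) ∧ 0 < m ∧ (∀ i, ¬ p ∣ a i) ∧
              (∑ j : Fin p, c j ^ p * g₀ ^ (j : ℕ)) = (u : K) * ∏ i : Fin m, ((t (Fin.castLE hmd i) : ↥(locAtCentre A'.toSubring O)) : K) ^ (a i)) ∨
            (∃ u : ↥(locAtCentre A'.toSubring O), IsUnit u ∧ (∑ j : Fin p, c j ^ p * g₀ ^ (j : ℕ)) = (u : K) ∧
              ∀ c' : ↥(locAtCentre A'.toSubring O), u - c' ^ p ∉ IsLocalRing.maximalIdeal ↥(locAtCentre A'.toSubring O)) ∨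
            (∃ s c' : ↥(locAtCentre A'.toSubring O), (∑ j : Fin p, c j ^ p * g₀ ^ (j : ℕ)) = (s : K) ∧
              s - c' ^ p ∈ IsLocalRing.maximalIdeal ↥(locAtCentre A'.toSubring O) ∧
              s - c' ^ p ∉ IsLocalRing.maximalIdeal ↥(locAtCentre A'.toSubring O) ^ 2)) := by
  intro p hp k _ _ K _ _ O A hAO hAfg hfrac _ hreg hdim3 g₀ hg₀
  exact cleanLU_of_frame_of_dimThreeCentre hF p hp k K O A hAO hAfg hfrac hreg hdim3 g₀ hg₀

end Summit.ResolutionOfSingularities.ResolutionOfSingularities.Theorems.RadicialJung.CleanModels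

end
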